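import Summits.BirchSwinnertonDyer.BirchSwinnertonDyer.Theorems.ThetaPartnerAtTwoSignedControlAtTwoPlusHondaPointsTwo
import Summits.BirchSwinnertonDyer.BirchSwinnertonDyer.Theorems.ThetaPartnerAtTwoSignedKatoUpToAtTwoLocalTwoModel
import Summits.BirchSwinnertonDyer.Rank1Residual.Additive.KobayashiLayerSaturation
import HarnessLib

/-!
# The PLUS tower at `2`, XI: the BOTTOM of the plus tower — `E(ℚ₂) = ℤ·e_2 + 2E(ℚ₂)` for the plus Honda point `e_2 = c_2 + ι·c_2`
# (`Λ(e_2) = −2`): clause (GEN₀) of HONDA⁺@2 in `Ω`-currency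
# (K4 `SignedControlAtTwo`, stmt-BirchSwinnertonDyer-20309, line `eulerchar` v6 — memo LAGPLUS-AT-2 §2 NORMS, §7 (c))

Route `ThetaPartnerAtTwo` (TP2; shared with `ResidualThetaTransportAtTwo`), crux K4, lead seat `prover-bsd-wall-tp2-p3` (g2). Sequel of VII–X.
At the bottom `ℚ₂ = ℚ₂(v_2)` (`v_2 = ζ_4 + ζ_4⁻¹ − 2 = −2`) the plus point is `e_2 = c_2 + ι·c_2` with `Λ(e_2) = ℓ_2 + ιℓ_2 = (ζ_4 − 1) + (ζ_4⁻¹ − 1) = −2`,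
an element of EXACT valuation `1`; since `Λ(Ŵ(ℚ₂)) ⊆ 2ℤ₂` (`‖log z − z‖ ≤ 2‖z‖²`, `‖z‖ ≤ 1/2` on `ℚ₂`-points) and `Λ` is a bijection
`{‖z‖ ≤ 1/4} → 4ℤ₂` up to (absent) torsion, every `P ∈ Ŵ(ℚ₂)` is `a·e_2 + 2R` (`a ∈ ℤ` with `Λ(P)/2 + a ∈ 4ℤ₂`... precisely `Λ(P + a'e_2) ∈ 8ℤ₂`,
`R` the point with `Λ(R) = Λ(P + a'e_2)/2 ∈ 4ℤ₂`); `#W̃(𝔽₂) = 3` passes from `Ŵ` to `E(ℚ₂)`.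

WHAT (`M/ℤ₂` elliptic fibres, `2 ∣ a₁`, `a₂ = 0`; `Ω = ℚ̄₂`; `F₀ = ℚ₂⟮v_2⟯` (= `ℚ₂` inside `Ω`, the bottom plus field in the currency of files V–X)):
`exists_algebraMap_eq_of_mem_adjoin_v_two`, `ell_two_two`, `plusPoint_two_mem` (`e_2 ∈ L(F₀) ∩ E₁`, `Λ(e_2) = −2`), `norm_ptLog_le_half`
(`‖Λ(P)‖ ≤ 1/2` on `E₁(OmegaSubfield 2 F₀)`), **`genZero_of_kernel`** / **`genZero`** (model level, torsion hypothesis on `L(ℚ₂(ζ_4))`),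
**`genZero_of_goodSS`** (for `W`: `GoodSS W 2`, `a₂(W) = 0`): every `P ∈ L(F₀)` is `a • e_2 + 2 • R`, `a ∈ ℤ`, `R ∈ L(F₀)` — the literal shape
of clause (GEN₀) `P = a • d 0 + 2 • R`.
HONEST FRAMING: THEOREMS ONLY (no definition, no named fact, no instance, no `sorry`); local theory at `2`; nothing about any Selmer group;
closes no item; BSD is not proved by any of this.

References: [Kobayashi2003] §8.4, Lemma 8.9; [SilvermanAEC2009] IV.6.3–6.4, VII.2.1.
-/

set_option autoImplicit false
-- the Theorems namespace of this sub repeats the summit name by design (D-0017 nested layout)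
set_option linter.dupNamespace false

noncomputable section

open scoped Classical Topology NNReal IntermediateField
open Filter PowerSeries Finset Polynomial

namespace Summit.BirchSwinnertonDyer.BirchSwinnertonDyer.Theorems.SignedEC.PlusTower

open Literature.RingTheory.FormalGroups WeierstrassCurve Field Field.absoluteGaloisGroup
open Summit.BirchSwinnertonDyer.Rank1Residual.Additive
open Summit.BirchSwinnertonDyer.Rank1Residual.Additive.PadicCyclotomicTower
open Summit.BirchSwinnertonDyer.Rank1Residual.Additive.BallEval
open Literature.NumberTheory.EllipticCurves Literature.NumberTheory.EllipticCurves.FormalGroupChart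
open Literature.NumberTheory.EllipticCurves.Rank1Residual
open Summit.BirchSwinnertonDyer.BirchSwinnertonDyer.Theorems.SignedKatoOffTwo.LocalAllPrimes
open Summit.BirchSwinnertonDyer.BirchSwinnertonDyer.Theorems.SignedKatoOffTwo.LocalTwo
open Summit.BirchSwinnertonDyer.BirchSwinnertonDyer.Theorems.SignedEC.OmegaSubfield

/-! ## §1 The bottom plus field `ℚ₂⟮v_2⟯ = ℚ₂` -/

/-- Elements of `ℚ₂(v_2)` are rational: `x = q` for some `q ∈ ℚ₂` (`[ℚ₂(v_2) : ℚ₂] = 2^0 = 1`). [folklore] -/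
theorem exists_algebraMap_eq_of_mem_adjoin_v_two {x : PadicAlgCl 2} (hx : x ∈ ℚ_[2]⟮zeta 2 2 + (zeta 2 2)⁻¹ - 2⟯) :
    ∃ q : ℚ_[2], algebraMap ℚ_[2] (PadicAlgCl 2) q = x := by
  obtain ⟨r, hr, rfl⟩ := exists_aeval_v_eq (le_refl 2) hx
  have hr0 : r.natDegree = 0 := by
    have : r.natDegree < 1 := by simpa using hr
    omega
  refine ⟨r.coeff 0, ?_⟩
  conv_rhs => rw [Polynomial.eq_C_of_natDegree_eq_zero hr0]
  rw [aeval_C]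

/-- `‖q‖ < 1 ⇒ ‖q‖ ≤ 1/2` in `ℚ₂`. [folklore] -/
theorem norm_le_half_of_norm_lt_one {q : ℚ_[2]} (h : ‖q‖ < 1) : ‖q‖ ≤ 1 / 2 := by
  have := (Padic.norm_le_pow_iff_norm_lt_pow_add_one q (-1)).mpr (by simpa using h)
  simpa using this

/-- `ℓ_2 = ζ_4 − 1` at `p = 2` (the `k = 1` term `(ζ_0 − 1)/2` vanishes). [cite: Kobayashi2003, Lemma 8.9] -/
theorem ell_two_two : ell 2 2 = zeta 2 2 - 1 := by
  rw [ell, Finset.sum_range_succ, Finset.sum_range_one]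
  simp [zeta_zero]

/-! ## §2 The bottom plus point `e_2 = c_2 + ι·c_2` -/

section Model

variable {M : WeierstrassCurve ℤ_[2]} [hE : (M.map PadicInt.Coe.ringHom).IsElliptic]
  [hintΩ : (genFibΩ 2 M).IsIntegral (Valued.v (R := PadicAlgCl 2)).integer]

/-- **The bottom plus point**: for `c ∈ L(ℚ₂(ζ_4)) ∩ E₁` with `Λ(c) = ℓ_2` and `ι` with `ι ζ_8 = −ζ_8⁻¹` (so `ι ζ_4 = ζ_4⁻¹`): `e_2 = c + ι·c`
lies in `L(ℚ₂(v_2)) ∩ E₁` and **`Λ(e_2) = −2`**. [cite: Kobayashi2003, Lemma 8.9] -/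
theorem plusPoint_two_mem
    (act : absoluteGaloisGroup ℚ_[2] → (genFibΩ 2 M).toAffine.Point → (genFibΩ 2 M).toAffine.Point)
    (hact0 : ∀ σ, act σ 0 = 0)
    (hact : ∀ σ (x y : PadicAlgCl 2) (h : (genFibΩ 2 M).toAffine.Nonsingular x y),
      ∃ h', act σ (Affine.Point.some x y h) = Affine.Point.some (σ • x) (σ • y) h')
    {ι : absoluteGaloisGroup ℚ_[2]} (hι : toAlgEquiv ℚ_[2] ι (zeta 2 3) = zeta 2 3 ^ (2 ^ 2 + (2 ^ 3 - 1)))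
    {c : (genFibΩ 2 M).toAffine.Point} (hcL : c ∈ subfieldPoints (genFibΩ 2 M) (layer 2 2).toSubfield coeffs_mem_layer)
    (hck : c ∈ kernel (Valued.v (R := PadicAlgCl 2)) (genFibΩ 2 M)) (hcℓ : ptLogΩ 2 M c = ell 2 2) :
    c + act ι c ∈ subfieldPoints (genFibΩ 2 M) (ℚ_[2]⟮zeta 2 2 + (zeta 2 2)⁻¹ - 2⟯).toSubfield (coeffs_mem_adjoin M _) ∧
      c + act ι c ∈ kernel (Valued.v (R := PadicAlgCl 2)) (genFibΩ 2 M) ∧ ptLogΩ 2 M (c + act ι c) = -2 := by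
  haveI := isIntegral_curveK 2 (LayerField 2 2) M
  have hιζ : toAlgEquiv ℚ_[2] ι (zeta 2 2) = (zeta 2 2)⁻¹ := apply_zeta_eq_inv_of hι
  have hιcL := act_mem_subfieldPoints act hact0 hact ι hcL
  have hιck : act ι c ∈ kernel (Valued.v (R := PadicAlgCl 2)) (genFibΩ 2 M) := act_mem_kernel act hact0 hact ι hck
  have heL : c + act ι c ∈ subfieldPoints (genFibΩ 2 M) (layer 2 2).toSubfield coeffs_mem_layer :=
    (subfieldPoints _ _ _).add_mem hcL hιcL
  have hek : c + act ι c ∈ kernel (Valued.v (R := PadicAlgCl 2)) (genFibΩ 2 M) :=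
    (kernel (Valued.v (R := PadicAlgCl 2)) (genFibΩ 2 M)).add_mem hck hιck
  have hfix : act ι (c + act ι c) = c + act ι c := by
    rw [act_add act hact0 hact, act_act_eq_self act hact0 hact hιζ hcL, add_comm]
  refine ⟨mem_subfieldPoints_adjoin_v_of_inv_act_eq act hact (le_refl 2) hιζ heL hfix, hek, ?_⟩
  have hcz : ‖c.zCoord‖ < 1 := by
    have := val_zCoord_lt_one hck
    rwa [PadicAlgCl.valuation_def, ← NNReal.coe_lt_coe, coe_nnnorm, NNReal.coe_one] at this
  rw [ptLogΩ_add (m := 2) hcL hιcL hck hιck, ptLogΩ_act act hact0 hact ι hcz, hcℓ, ell_two_two, smul_sub, smul_one,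
    absoluteGaloisGroup.smul_def, hιζ]
  have hu := u_two
  linear_combination hu

/-! ## §3 `Λ(Ŵ(ℚ₂)) ⊆ 2ℤ₂` and the generation of `Ŵ(ℚ₂)` by `e_2` modulo `2` -/

omit hE hintΩ in
/-- **`‖Λ(P)‖ ≤ 1/2` on `E₁` over the bottom plus field** (`‖z‖ < 1 ⇒ ‖z‖ ≤ 1/2` for rational `z`, and `‖log z − z‖ ≤ 2‖z‖²`).
[cite: SilvermanAEC2009, IV.6.3] -/
theorem norm_ptLog_le_half
    [hint : (curveK 2 (OmegaSubfield 2 ℚ_[2]⟮zeta 2 2 + (zeta 2 2)⁻¹ - 2⟯) M).IsIntegral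
      (NormedField.valuation (K := OmegaSubfield 2 ℚ_[2]⟮zeta 2 2 + (zeta 2 2)⁻¹ - 2⟯)).integer]
    {P : (curveK 2 (OmegaSubfield 2 ℚ_[2]⟮zeta 2 2 + (zeta 2 2)⁻¹ - 2⟯) M).toAffine.Point}
    (hP : P ∈ kernel (NormedField.valuation (K := OmegaSubfield 2 ℚ_[2]⟮zeta 2 2 + (zeta 2 2)⁻¹ - 2⟯))
      (curveK 2 (OmegaSubfield 2 ℚ_[2]⟮zeta 2 2 + (zeta 2 2)⁻¹ - 2⟯) M)) :
    ‖ptLog 2 (OmegaSubfield 2 ℚ_[2]⟮zeta 2 2 + (zeta 2 2)⁻¹ - 2⟯) M P‖ ≤ 1 / 2 := by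
  haveI : FiniteDimensional ℚ_[2] (↥(ℚ_[2]⟮zeta 2 2 + (zeta 2 2)⁻¹ - 2⟯)) :=
    IntermediateField.adjoin.finiteDimensional (Algebra.IsIntegral.isIntegral _)
  set z := P.zCoord with hz
  have hz1 : ‖z‖ < 1 := norm_zCoord_lt_one hP
  obtain ⟨qz, hqz⟩ := exists_algebraMap_eq_of_mem_adjoin_v_two (emb_mem z)
  have hzq : ‖z‖ = ‖qz‖ := by rw [← norm_emb, ← hqz, norm_algebraMap']
  have hz2 : ‖z‖ ≤ 1 / 2 := by rw [hzq]; exact norm_le_half_of_norm_lt_one (by rwa [← hzq])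
  have hb := norm_bLog_sub_le_two (p := 2) (K := OmegaSubfield 2 ℚ_[2]⟮zeta 2 2 + (zeta 2 2)⁻¹ - 2⟯) (M := M) hz2
  rw [ptLog, ← hz]
  have e : bLog 2 _ M z = (bLog 2 _ M z - z) + z := by ring
  rw [e]
  refine (IsUltrametricDist.norm_add_le_max _ _).trans (max_le ?_ hz2)
  refine hb.trans ?_
  nlinarith [norm_nonneg z, hz2]

/-- **(GEN₀) on the formal group**: `Ŵ(ℚ₂) = ℤ·e_2 + 2·Ŵ(ℚ₂)` — for `P ∈ L(ℚ₂(v_2)) ∩ E₁` there are `a ∈ ℤ` and `R ∈ L(ℚ₂(v_2)) ∩ E₁` with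
`P = a • e_2 + 2 • R` (`M` with elliptic fibres, `2 ∣ a₁` via the torsion hypothesis on `L(ℚ₂(ζ_4))`). [cite: Kobayashi2003, §8.4] -/
theorem genZero_of_kernel
    (act : absoluteGaloisGroup ℚ_[2] → (genFibΩ 2 M).toAffine.Point → (genFibΩ 2 M).toAffine.Point)
    (hact0 : ∀ σ, act σ 0 = 0)
    (hact : ∀ σ (x y : PadicAlgCl 2) (h : (genFibΩ 2 M).toAffine.Nonsingular x y),
      ∃ h', act σ (Affine.Point.some x y h) = Affine.Point.some (σ • x) (σ • y) h')
    (htors : ∀ Q ∈ subfieldPoints (genFibΩ 2 M) (layer 2 2).toSubfield coeffs_mem_layer, ∀ k : ℕ, 2 ^ k • Q = 0 → Q = 0)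
    {ι : absoluteGaloisGroup ℚ_[2]} (hι : toAlgEquiv ℚ_[2] ι (zeta 2 3) = zeta 2 3 ^ (2 ^ 2 + (2 ^ 3 - 1)))
    {c : (genFibΩ 2 M).toAffine.Point} (hcL : c ∈ subfieldPoints (genFibΩ 2 M) (layer 2 2).toSubfield coeffs_mem_layer)
    (hck : c ∈ kernel (Valued.v (R := PadicAlgCl 2)) (genFibΩ 2 M)) (hcℓ : ptLogΩ 2 M c = ell 2 2)
    {P : (genFibΩ 2 M).toAffine.Point}
    (hP : P ∈ subfieldPoints (genFibΩ 2 M) (ℚ_[2]⟮zeta 2 2 + (zeta 2 2)⁻¹ - 2⟯).toSubfield (coeffs_mem_adjoin M _))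
    (hPk : P ∈ kernel (Valued.v (R := PadicAlgCl 2)) (genFibΩ 2 M)) :
    ∃ a : ℤ, ∃ R ∈ subfieldPoints (genFibΩ 2 M) (ℚ_[2]⟮zeta 2 2 + (zeta 2 2)⁻¹ - 2⟯).toSubfield (coeffs_mem_adjoin M _),
      R ∈ kernel (Valued.v (R := PadicAlgCl 2)) (genFibΩ 2 M) ∧ P = a • (c + act ι c) + 2 • R := by
  haveI : FiniteDimensional ℚ_[2] (↥ℚ_[2]⟮zeta 2 2 + (zeta 2 2)⁻¹ - 2⟯) :=
    IntermediateField.adjoin.finiteDimensional (Algebra.IsIntegral.isIntegral _)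
  haveI := isIntegral_curveK 2 (OmegaSubfield 2 ℚ_[2]⟮zeta 2 2 + (zeta 2 2)⁻¹ - 2⟯) M
  have hle : (ℚ_[2]⟮zeta 2 2 + (zeta 2 2)⁻¹ - 2⟯).toSubfield ≤ (layer 2 2).toSubfield := adjoin_v_le_layer 2
  obtain ⟨heL, hek, heΛ⟩ := plusPoint_two_mem act hact0 hact hι hcL hck hcℓ
  set e := c + act ι c with he
  -- lift `P` and `e` to the complete field `K = OmegaSubfield 2 ℚ₂⟮v_2⟯`
  obtain ⟨PK, rfl⟩ := exists_toOmegaF_eq hP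
  have hPKk : PK ∈ kernel (NormedField.valuation (K := OmegaSubfield 2 ℚ_[2]⟮zeta 2 2 + (zeta 2 2)⁻¹ - 2⟯)) (curveK 2 (OmegaSubfield 2 ℚ_[2]⟮zeta 2 2 + (zeta 2 2)⁻¹ - 2⟯) M) :=
    (toOmegaF_mem_kernel_iff PK).mp hPk
  obtain ⟨eK, heK⟩ := exists_toOmegaF_eq heL
  have heKk : eK ∈ kernel (NormedField.valuation (K := OmegaSubfield 2 ℚ_[2]⟮zeta 2 2 + (zeta 2 2)⁻¹ - 2⟯)) (curveK 2 (OmegaSubfield 2 ℚ_[2]⟮zeta 2 2 + (zeta 2 2)⁻¹ - 2⟯) M) :=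
    (toOmegaF_mem_kernel_iff eK).mp (heK ▸ hek)
  have hΛeK : ptLog 2 (OmegaSubfield 2 ℚ_[2]⟮zeta 2 2 + (zeta 2 2)⁻¹ - 2⟯) M eK = -2 := by
    apply emb_injective
    rw [← ptLogΩ_toOmegaF heKk, heK, heΛ, map_neg, map_ofNat]
  -- `Λ(PK) = q ∈ ℚ₂`, `‖q‖ ≤ 1/2`
  obtain ⟨q, hq⟩ := exists_algebraMap_eq_of_mem_adjoin_v_two (emb_mem (ptLog 2 (OmegaSubfield 2 ℚ_[2]⟮zeta 2 2 + (zeta 2 2)⁻¹ - 2⟯) M PK))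
  have hqn : ‖q‖ ≤ 1 / 2 := by
    rw [← norm_algebraMap' (PadicAlgCl 2), hq, norm_emb]; exact norm_ptLog_le_half hPKk
  -- `w = q/2 ∈ ℤ₂`, `a' ≡ w (mod 4)`
  have hw1 : ‖q / 2‖ ≤ 1 := by
    have h2 : ‖(2 : ℚ_[2])‖ = 2⁻¹ := by
      have := Padic.norm_p (p := 2)
      exact_mod_cast this
    rw [norm_div, h2, div_inv_eq_mul]
    linarith
  set wZ : ℤ_[2] := ⟨q / 2, hw1⟩ with hwZ
  set a' : ℕ := wZ.appr 2 with ha'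
  have hy4 : ‖q / 2 - (a' : ℚ_[2])‖ ≤ 1 / 4 := by
    have hmem := PadicInt.appr_spec 2 wZ
    rw [← ha'] at hmem
    have hn := (PadicInt.norm_le_pow_iff_mem_span_pow _ 2).mpr hmem
    have e : ((wZ - (a' : ℤ_[2]) : ℤ_[2]) : ℚ_[2]) = q / 2 - (a' : ℚ_[2]) := by push_cast; rfl
    rw [← PadicInt.padic_norm_e_of_padicInt, e] at hn
    refine hn.trans ?_
    norm_num
  set y : ℚ_[2] := q / 2 - (a' : ℚ_[2]) with hy
  set yK : OmegaSubfield 2 ℚ_[2]⟮zeta 2 2 + (zeta 2 2)⁻¹ - 2⟯ := algebraMap ℚ_[2] (OmegaSubfield 2 ℚ_[2]⟮zeta 2 2 + (zeta 2 2)⁻¹ - 2⟯) y with hyK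
  have hyK4 : ‖yK‖ ≤ 1 / 4 := by rw [hyK, norm_algebraMap']; exact hy4
  obtain ⟨RK, hRKk, hΛR, -⟩ := exists_ptLog_eq (p := 2) (M := M) hyK4
  -- `Λ(PK + a'•eK) = 2 yK`
  have haeK : a' • eK ∈ kernel (NormedField.valuation (K := OmegaSubfield 2 ℚ_[2]⟮zeta 2 2 + (zeta 2 2)⁻¹ - 2⟯)) (curveK 2 (OmegaSubfield 2 ℚ_[2]⟮zeta 2 2 + (zeta 2 2)⁻¹ - 2⟯) M) :=
    (kernel _ _).nsmul_mem heKk a'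
  have hQk : PK + a' • eK ∈ kernel (NormedField.valuation (K := OmegaSubfield 2 ℚ_[2]⟮zeta 2 2 + (zeta 2 2)⁻¹ - 2⟯)) (curveK 2 (OmegaSubfield 2 ℚ_[2]⟮zeta 2 2 + (zeta 2 2)⁻¹ - 2⟯) M) :=
    (kernel _ _).add_mem hPKk haeK
  have hΛQ : ptLog 2 (OmegaSubfield 2 ℚ_[2]⟮zeta 2 2 + (zeta 2 2)⁻¹ - 2⟯) M (PK + a' • eK) = 2 * yK := by
    rw [ptLog_add hPKk haeK, ptLog_nsmul heKk, hΛeK]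
    apply emb_injective
    have h1 : emb 2 ℚ_[2]⟮zeta 2 2 + (zeta 2 2)⁻¹ - 2⟯ (ptLog 2 (OmegaSubfield 2 ℚ_[2]⟮zeta 2 2 + (zeta 2 2)⁻¹ - 2⟯) M PK) = algebraMap ℚ_[2] (PadicAlgCl 2) q := hq.symm
    simp only [map_add, map_mul, map_neg, map_natCast, map_ofNat, h1, hyK, AlgHom.commutes, hy, map_sub, map_div₀]
    ring
  -- `D = PK + a'•eK − 2•RK` has `Λ(D) = 0`, hence is torsion, hence `0`
  have h2Rk : 2 • RK ∈ kernel (NormedField.valuation (K := OmegaSubfield 2 ℚ_[2]⟮zeta 2 2 + (zeta 2 2)⁻¹ - 2⟯)) (curveK 2 (OmegaSubfield 2 ℚ_[2]⟮zeta 2 2 + (zeta 2 2)⁻¹ - 2⟯) M) :=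
    (kernel _ _).nsmul_mem hRKk 2
  have hDk : PK + a' • eK - 2 • RK ∈ kernel (NormedField.valuation (K := OmegaSubfield 2 ℚ_[2]⟮zeta 2 2 + (zeta 2 2)⁻¹ - 2⟯)) (curveK 2 (OmegaSubfield 2 ℚ_[2]⟮zeta 2 2 + (zeta 2 2)⁻¹ - 2⟯) M) :=
    (kernel _ _).sub_mem hQk h2Rk
  have hΛD : ptLog 2 (OmegaSubfield 2 ℚ_[2]⟮zeta 2 2 + (zeta 2 2)⁻¹ - 2⟯) M (PK + a' • eK - 2 • RK) = 0 := by
    have h := ptLog_add hDk h2Rk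
    rw [sub_add_cancel, hΛQ, ptLog_nsmul hRKk, hΛR] at h
    have h2 : ((2 : ℕ) : OmegaSubfield 2 ℚ_[2]⟮zeta 2 2 + (zeta 2 2)⁻¹ - 2⟯) = 2 := by norm_cast
    rw [h2] at h
    linear_combination -h
  obtain ⟨k, hk⟩ := BallEval.exists_pow_smul_eq_zero_of_ptLog_eq_zero hDk hΛD
  have hDΩL : toOmega 2 ℚ_[2]⟮zeta 2 2 + (zeta 2 2)⁻¹ - 2⟯ M (PK + a' • eK - 2 • RK) ∈ subfieldPoints (genFibΩ 2 M) (layer 2 2).toSubfield coeffs_mem_layer :=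
    mem_subfieldPoints_of_le _ coeffs_mem_layer hle (toOmegaF_mem_subfieldPoints _)
  have hD0 : toOmega 2 ℚ_[2]⟮zeta 2 2 + (zeta 2 2)⁻¹ - 2⟯ M (PK + a' • eK - 2 • RK) = 0 :=
    htors _ hDΩL k (by rw [← map_nsmul, hk, map_zero])
  -- conclude
  refine ⟨-(a' : ℤ), toOmega 2 ℚ_[2]⟮zeta 2 2 + (zeta 2 2)⁻¹ - 2⟯ M RK, toOmegaF_mem_subfieldPoints RK, (toOmegaF_mem_kernel_iff RK).mpr hRKk, ?_⟩
  have h' : toOmega 2 ℚ_[2]⟮zeta 2 2 + (zeta 2 2)⁻¹ - 2⟯ M PK + a' • e - 2 • toOmega 2 ℚ_[2]⟮zeta 2 2 + (zeta 2 2)⁻¹ - 2⟯ M RK = 0 := by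
    rw [← hD0, map_sub, map_add, map_nsmul, map_nsmul, heK]
  have h'' := sub_eq_zero.mp h'
  rw [neg_smul, natCast_zsmul, ← h'']
  abel

variable [hEt : (M.map PadicInt.toZMod).IsElliptic]

/-- **(GEN₀) for all points of `E(ℚ₂)`** (model level): for `P ∈ L(ℚ₂(v_2))` there are `a ∈ ℤ`, `R ∈ L(ℚ₂(v_2))` with `P = a • e_2 + 2 • R`
(`3•P ∈ Ŵ` as `#W̃(𝔽₂) = 3`, then `P = 3•P − 2•P`). [cite: Kobayashi2003, §8.4] -/
theorem genZero (htr : Literature.NumberTheory.EllipticCurves.HasseManin.tr (M.map PadicInt.toZMod) = 0)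
    (act : absoluteGaloisGroup ℚ_[2] → (genFibΩ 2 M).toAffine.Point → (genFibΩ 2 M).toAffine.Point)
    (hact0 : ∀ σ, act σ 0 = 0)
    (hact : ∀ σ (x y : PadicAlgCl 2) (h : (genFibΩ 2 M).toAffine.Nonsingular x y),
      ∃ h', act σ (Affine.Point.some x y h) = Affine.Point.some (σ • x) (σ • y) h')
    (htors : ∀ Q ∈ subfieldPoints (genFibΩ 2 M) (layer 2 2).toSubfield coeffs_mem_layer, ∀ k : ℕ, 2 ^ k • Q = 0 → Q = 0)
    {ι : absoluteGaloisGroup ℚ_[2]} (hι : toAlgEquiv ℚ_[2] ι (zeta 2 3) = zeta 2 3 ^ (2 ^ 2 + (2 ^ 3 - 1)))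
    {c : (genFibΩ 2 M).toAffine.Point} (hcL : c ∈ subfieldPoints (genFibΩ 2 M) (layer 2 2).toSubfield coeffs_mem_layer)
    (hck : c ∈ kernel (Valued.v (R := PadicAlgCl 2)) (genFibΩ 2 M)) (hcℓ : ptLogΩ 2 M c = ell 2 2)
    {P : (genFibΩ 2 M).toAffine.Point}
    (hP : P ∈ subfieldPoints (genFibΩ 2 M) (ℚ_[2]⟮zeta 2 2 + (zeta 2 2)⁻¹ - 2⟯).toSubfield (coeffs_mem_adjoin M _)) :
    ∃ a : ℤ, ∃ R ∈ subfieldPoints (genFibΩ 2 M) (ℚ_[2]⟮zeta 2 2 + (zeta 2 2)⁻¹ - 2⟯).toSubfield (coeffs_mem_adjoin M _),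
      P = a • (c + act ι c) + 2 • R := by
  have hle : (ℚ_[2]⟮zeta 2 2 + (zeta 2 2)⁻¹ - 2⟯).toSubfield ≤ (layer 2 2).toSubfield := adjoin_v_le_layer 2
  have h3L : 3 • P ∈ subfieldPoints (genFibΩ 2 M) (ℚ_[2]⟮zeta 2 2 + (zeta 2 2)⁻¹ - 2⟯).toSubfield (coeffs_mem_adjoin M _) :=
    (subfieldPoints _ _ _).nsmul_mem hP 3
  have h3k : 3 • P ∈ kernel (Valued.v (R := PadicAlgCl 2)) (genFibΩ 2 M) := by
    have h : Nat.card (M.map PadicInt.toZMod).toAffine.Point • P ∈ kernel (Valued.v (R := PadicAlgCl 2)) (genFibΩ 2 M) :=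
      card_smul_mem_kernel_of_mem_subfieldPoints M (mem_subfieldPoints_of_le _ coeffs_mem_layer hle hP)
    rw [natCard_point_eq_of_tr_eq_zero _ htr, show (2 + 1 : ℕ) = 3 from rfl] at h
    assumption
  obtain ⟨a, R, hRL, -, h3⟩ := genZero_of_kernel act hact0 hact htors hι hcL hck hcℓ h3L h3k
  refine ⟨a, R - P, (subfieldPoints _ _ _).sub_mem hRL hP, ?_⟩
  have e3 : (3 : ℕ) • P = P + 2 • P := by rw [show (3 : ℕ) = 1 + 2 from rfl, add_nsmul, one_nsmul]
  rw [smul_sub, ← sub_eq_zero]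
  have h3' := sub_eq_zero.mpr h3
  rw [e3] at h3'
  rw [← h3']
  abel

end Model

/-! ## §4 For the curve `W` itself -/

section Curve

variable (W : WeierstrassCurve ℚ) [W.IsElliptic] [W.IsGloballyMinimal]
  [hintΩ : (genFibΩ 2 ((integralModelInt W).map (Int.castRingHom ℤ_[2]))).IsIntegral (Valued.v (R := PadicAlgCl 2)).integer]

/-- **(GEN₀) FOR `W` ITSELF** (`GoodSS W 2`, `a₂(W) = 0`): on `M_W`, with `ι ζ_8 = −ζ_8⁻¹` and a tower point `c_2 ∈ L(ℚ₂(ζ_4)) ∩ Ŵ` with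
`Λ(c_2) = ℓ_2` (e.g. from `exists_plusSystem_of_goodSS`), the bottom plus point `e_2 = c_2 + ι·c_2 ∈ L(ℚ₂) ∩ Ŵ` has `Λ(e_2) = −2` and every
point `P` of `W` rational over `ℚ₂ = ℚ₂(v_2)` is `a • e_2 + 2 • R` with `a ∈ ℤ`, `R` rational — clause (GEN₀) of `stub_plusHondaSystemTwo` in
`Ω`-currency (and «`e_2 ∉ 2E(ℚ₂)`»-type statements follow from `Λ(e_2) = −2 ∉ Λ(2Ŵ(ℚ₂)) ⊆ 4ℤ₂`). [cite: Kobayashi2003, §8.4] -/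
theorem genZero_of_goodSS (hss : GoodSS W 2) (ha : W.frobeniusTrace 2 = 0)
    (act : absoluteGaloisGroup ℚ_[2] → (genFibΩ 2 ((integralModelInt W).map (Int.castRingHom ℤ_[2]))).toAffine.Point →
      (genFibΩ 2 ((integralModelInt W).map (Int.castRingHom ℤ_[2]))).toAffine.Point)
    (hact0 : ∀ σ, act σ 0 = 0)
    (hact : ∀ σ (x y : PadicAlgCl 2) (h : (genFibΩ 2 ((integralModelInt W).map (Int.castRingHom ℤ_[2]))).toAffine.Nonsingular x y),
      ∃ h', act σ (Affine.Point.some x y h) = Affine.Point.some (σ • x) (σ • y) h')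
    {ι : absoluteGaloisGroup ℚ_[2]} (hι : toAlgEquiv ℚ_[2] ι (zeta 2 3) = zeta 2 3 ^ (2 ^ 2 + (2 ^ 3 - 1)))
    {c : (genFibΩ 2 ((integralModelInt W).map (Int.castRingHom ℤ_[2]))).toAffine.Point}
    (hcL : c ∈ subfieldPoints (genFibΩ 2 ((integralModelInt W).map (Int.castRingHom ℤ_[2]))) (layer 2 2).toSubfield coeffs_mem_layer)
    (hck : c ∈ kernel (Valued.v (R := PadicAlgCl 2)) (genFibΩ 2 ((integralModelInt W).map (Int.castRingHom ℤ_[2]))))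
    (hcℓ : ptLogΩ 2 ((integralModelInt W).map (Int.castRingHom ℤ_[2])) c = ell 2 2)
    {P : (genFibΩ 2 ((integralModelInt W).map (Int.castRingHom ℤ_[2]))).toAffine.Point}
    (hP : P ∈ subfieldPoints (genFibΩ 2 ((integralModelInt W).map (Int.castRingHom ℤ_[2])))
      (ℚ_[2]⟮zeta 2 2 + (zeta 2 2)⁻¹ - 2⟯).toSubfield (coeffs_mem_adjoin _ _)) :
    (c + act ι c ∈ subfieldPoints (genFibΩ 2 ((integralModelInt W).map (Int.castRingHom ℤ_[2])))
        (ℚ_[2]⟮zeta 2 2 + (zeta 2 2)⁻¹ - 2⟯).toSubfield (coeffs_mem_adjoin _ _) ∧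
      ptLogΩ 2 ((integralModelInt W).map (Int.castRingHom ℤ_[2])) (c + act ι c) = -2) ∧
    ∃ a : ℤ, ∃ R ∈ subfieldPoints (genFibΩ 2 ((integralModelInt W).map (Int.castRingHom ℤ_[2])))
        (ℚ_[2]⟮zeta 2 2 + (zeta 2 2)⁻¹ - 2⟯).toSubfield (coeffs_mem_adjoin _ _),
      P = a • (c + act ι c) + 2 • R := by
  haveI := isElliptic_coe_twoAdicModel W
  haveI := isElliptic_toZMod_twoAdicModel W hss.1
  have htr : Literature.NumberTheory.EllipticCurves.HasseManin.tr
      (((integralModelInt W).map (Int.castRingHom ℤ_[2])).map PadicInt.toZMod) = 0 := by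
    rw [tr_twoAdicModel W hss.1, ha]
  have htors : ∀ Q ∈ subfieldPoints (genFibΩ 2 ((integralModelInt W).map (Int.castRingHom ℤ_[2]))) (layer 2 2).toSubfield
      coeffs_mem_layer, ∀ k : ℕ, 2 ^ k • Q = 0 → Q = 0 :=
    fun Q hQ k hk ↦ eq_zero_of_two_pow_smul_eq_zero_layer_of_goodSS W hss 2 hQ hk
  obtain ⟨heL, -, heΛ⟩ := plusPoint_two_mem act hact0 hact hι hcL hck hcℓ
  exact ⟨⟨heL, heΛ⟩, genZero htr act hact0 hact htors hι hcL hck hcℓ hP⟩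

end Curve


end Summit.BirchSwinnertonDyer.BirchSwinnertonDyer.Theorems.SignedEC.PlusTower

end
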